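import Summits.QuantumFields.BalabanUV.Beta.ValueHessianBlind

/-!
# (J1), BORDER + SUM: the STRAIGHT-BORDER step candidate `bhKStep d Lc (j+1) = [[wVH·E2, M^{d+2}·(bhK Lc)_fm],[M^{d+2}·(bhK Lc)_mf, 0]]`
# is BLIND to the block-mean axial dressing on both sides, and differs from the rooted candidate `bhKStepAt` on comb bonds only
# (β sub-cell, row BETA-an2 = BINDER-OWNERS row D1, gen 15; leaf L1.b of `gen15/SKELETON-D1-hR.v2.md`)

HONEST FRAMING (cell charter, verbatim): «discharging BetaPertH makes Balaban's UV stability UNCONDITIONAL — a real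
constructive-QFT result; it is NOT the continuum limit and NOT the Clay problem.»  DERIVED cell leaf (pub-balaban β sub-cell, lane
an2 gen 15); no statement of Bałaban's papers is typed here, no `[cite:]` tag, no `Prop` fact; it instantiates no binder of the
β-function wall by itself.  It is leaf L1.b ((J1) border + sum) of the hR skeleton; NOTHING is claimed about (J2)/(J3) (the step residual and
its absorption), hence nothing about rules 3–4 at `j ≥ 1` themselves.  NOT `BetaPertH`; NOT continuum; NOT Clay.

## What is here ([folklore] data definition + bookkeeping)

* §1 `bhKStep d Lc : ℕ → MKer (d+1) (Fib d)` — the STRAIGHT-border twin of `BorderedHessian.bhKStepAt d ρ Lc` (`BorderedHessianStep`): at `0`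
  the undressed bordered Hessian `bhK Lc`; at `j+1` the field block `wVH d Lc (j+1) · E2 d Lc (j+1)`, the border `stepScale d Lc (j+1) ·` that of
  `bhK Lc` (the STRAIGHT linearised averaging `±𝒬_{Lc}`), the multiplier block `0`; entries, `bhKStep_zero`;
* §2 **`combSupported_bhKStepAt_sub_bhKStep`**: `bhKStepAt d (toSite r) Lc (j+1) − bhKStep d Lc (j+1)` is COMB-SUPPORTED (it is `stepScale ·`
  the border of `bhKAt − bhK`, `BorderedHessianRooted.combSupported_bhKAt_sub_bhK`) — the input of the comb transfer
  `BorderedHessianRooted.relInv_of_combSupported_sub` from the straight to the rooted candidate (leaf L1.e);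
* §3 spread: `decays_bhKStep_succ`, `spr_bhKStep`;
* §4 ACTION LEMMAS of `bhKStep d Lc (j+1)` on a kernel `X`: field rows `wVH·(wΦ ⋆ X_{·zb}) − stepScale·𝒬ᵀ_{Lc}(mcol X)` (under summability of
  the value-Hessian part), multiplier rows `stepScale·[x coarse]·𝒬_{Lc}(fcol X)`;
* §5 **`comp_bhKStep_trK_piKBm : comp (bhKStep d Lc (j+1)) (trK (piKBm (toSite r) Lc)) = bhKStep d Lc (j+1)`** (RIGHT blindness: the field
  block by `ValueHessianBlind.tsum_mul_piKBm_inl_inl`, the border by `AxialProjectorBlockMean.contourSum_axProjBmAt`, exactly as at `j = 0` in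
  `BorderedHessianBlind.comp_bhK_trK_piKBm`);
* §6 `trK_bhKStep_succ : trK (bhKStep (j+1)) = sgnK (bhKStep (j+1))` (`wΦ_symm` + `trK_bhK`) and **`comp_piKBm_bhKStep`** (LEFT blindness by
  transposition, as `BorderedHessianBlind.comp_piKBm_bhK`).
All declarations `[folklore]`; axioms standard.  Provenance: b2b-balaban β sub-cell, unit beta-an2 gen 15, 2026-08-20 (v1); over
`ValueHessianBlind` (p206523), `BorderedHessianStep` (p206071), `BorderedHessianRooted`, `BorderedHessianBlind`, `BorderedHessianKernelAction`,
`BorderedHessianSymmetry` BY NAME; no existing file touched.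
-/

open Finset
open scoped BigOperators
open Literature.Probability.LatticeModels (TorusSite Torus.proj Torus.proj_apply)
open Literature.MathematicalPhysics.QuantumFieldTheory
open Literature.MathematicalPhysics.QuantumFieldTheory.Balaban1983to89
open Literature.MathematicalPhysics.QuantumFieldTheory.Balaban1983to89.Beta
open B12Sec2to5 (l1 l1_nonneg)
open ExpKernelCalculus (MKer Decays comp)
open AffineAveraging (Form0 Form1 Form2 box toSite unitVec unitVec_apply dz curv curvAdj codiff₁ contourSum)
open AffineReproduction (contourSumAdj)
open KKTFluctuationKernel (delta1 delta1_apply)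
open KernelSpecInstance (wΦ)
open LatticeForm (quo)
open OneStepResolventKernel (Fib KInv quo_zsmul eq_zsmul_quo_of_proj proj_zsmul)
open BalabanStepJetsSucc (E2 decays_E2 wVH)
open Summit.QuantumFields.BalabanUV.Beta.TameKernelCalculus
open Summit.QuantumFields.BalabanUV.Beta.AxialDressingRooted (cube mem_cube piKBm piKBm_inl_inl piKBm_inl_inr piKBm_inr_inl piKBm_inr_inr
  IsCombBondAt one_le_of_neZero)
open Summit.QuantumFields.BalabanUV.Beta.AxialProjectorBlockMean (axProjBmAt contourSum_axProjBmAt)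
open Summit.QuantumFields.BalabanUV.Beta.GAN24.TransverseDictionary (wΦ_symm)

namespace Summit.QuantumFields.BalabanUV.Beta.BorderedHessian

noncomputable section

variable (d : ℕ) (Lc : ℕ) [NeZero Lc]

/-! ## §1 The straight-border step candidate -/

/-- [folklore] **THE STRAIGHT-BORDER STEP CANDIDATE** `bhKStep d Lc j`: `bhK Lc` at `j = 0`; at `j + 1` the field block
`wVH (j+1) · E2 (j+1)`, the border `stepScale (j+1) ·` that of the UNDRESSED `bhK Lc` (straight averaging), the multiplier block `0` —
the twin of `bhKStepAt d ρ Lc` with `bhKAt ρ Lc ↦ bhK Lc` in the border. -/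
def bhKStep : ℕ → MKer (d + 1) (Fib d)
  | 0 => bhK Lc
  | j + 1 => fun x y a b =>
      match a, b with
      | Sum.inl κ, Sum.inl l => wVH d Lc (j + 1) * E2 d Lc (j + 1) x y (Sum.inl κ) (Sum.inl l)
      | Sum.inl κ, Sum.inr l => stepScale d Lc (j + 1) * bhK Lc x y (Sum.inl κ) (Sum.inr l)
      | Sum.inr κ, Sum.inl l => stepScale d Lc (j + 1) * bhK Lc x y (Sum.inr κ) (Sum.inl l)
      | Sum.inr _, Sum.inr _ => 0

variable {d Lc}

/-- [folklore] At `j = 0` the straight candidate is `bhK Lc`. -/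
@[simp] theorem bhKStep_zero : bhKStep d Lc 0 = bhK Lc := rfl

/-- [folklore] Field–field entry at `j + 1`. -/
theorem bhKStep_succ_inl_inl (j : ℕ) (x y : Fin (d + 1) → ℤ) (κ l : Fin (d + 1)) :
    bhKStep d Lc (j + 1) x y (Sum.inl κ) (Sum.inl l) = wVH d Lc (j + 1) * E2 d Lc (j + 1) x y (Sum.inl κ) (Sum.inl l) := rfl

/-- [folklore] Field–multiplier entry at `j + 1`. -/
theorem bhKStep_succ_inl_inr (j : ℕ) (x y : Fin (d + 1) → ℤ) (κ l : Fin (d + 1)) :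
    bhKStep d Lc (j + 1) x y (Sum.inl κ) (Sum.inr l) = stepScale d Lc (j + 1) * bhK Lc x y (Sum.inl κ) (Sum.inr l) := rfl

/-- [folklore] Multiplier–field entry at `j + 1`. -/
theorem bhKStep_succ_inr_inl (j : ℕ) (x y : Fin (d + 1) → ℤ) (κ l : Fin (d + 1)) :
    bhKStep d Lc (j + 1) x y (Sum.inr κ) (Sum.inl l) = stepScale d Lc (j + 1) * bhK Lc x y (Sum.inr κ) (Sum.inl l) := rfl

/-- [folklore] Multiplier–multiplier entry at `j + 1` vanishes. -/
theorem bhKStep_succ_inr_inr (j : ℕ) (x y : Fin (d + 1) → ℤ) (κ l : Fin (d + 1)) :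
    bhKStep d Lc (j + 1) x y (Sum.inr κ) (Sum.inr l) = 0 := rfl

/-! ## §2 The rooted and the straight candidates differ on comb bonds only -/

/-- [folklore] **`bhKStepAt d (toSite r) Lc (j+1) − bhKStep d Lc (j+1)` IS COMB-SUPPORTED** (in-block root): the two candidates share the
field block and the zero multiplier block, and their borders are `stepScale ·` those of `bhKAt` resp. `bhK`
(`combSupported_bhKAt_sub_bhK`). -/
theorem combSupported_bhKStepAt_sub_bhKStep {r : Fin (d + 1) → ℕ} (hr : r ∈ box (d + 1) Lc) (j : ℕ) (x y : Fin (d + 1) → ℤ)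
    (a b : Fib d) (hne : (bhKStepAt d (toSite r) Lc (j + 1) - bhKStep d Lc (j + 1)) x y a b ≠ 0) :
    (∃ κ, a = Sum.inl κ ∧ IsCombBondAt (toSite r) Lc κ x) ∨ (∃ l, b = Sum.inl l ∧ IsCombBondAt (toSite r) Lc l y) := by
  rw [Pi.sub_apply, Pi.sub_apply, Pi.sub_apply, Pi.sub_apply] at hne
  apply combSupported_bhKAt_sub_bhK hr x y a b
  rw [Pi.sub_apply, Pi.sub_apply, Pi.sub_apply, Pi.sub_apply]
  rcases a with κ | κ <;> rcases b with l | l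
  · exact absurd (by rw [bhKStepAt_succ_inl_inl, bhKStep_succ_inl_inl, sub_self]) hne
  · rw [bhKStepAt_succ_fm, bhKStep_succ_inl_inr, ← mul_sub] at hne
    exact fun h => hne (by rw [h, mul_zero])
  · rw [bhKStepAt_succ_mf, bhKStep_succ_inr_inl, ← mul_sub] at hne
    exact fun h => hne (by rw [h, mul_zero])
  · exact absurd (by rw [bhKStepAt_succ_mm, bhKStep_succ_inr_inr, sub_self]) hne

/-! ## §3 Spread -/

/-- [folklore] The straight candidate decays at `j + 1`. -/
theorem decays_bhKStep_succ (j : ℕ) : ∃ δ C : ℝ, 0 < δ ∧ 0 ≤ C ∧ Decays (bhKStep d Lc (j + 1)) C δ := by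
  have hLc : 1 ≤ Lc := one_le_of_neZero Lc
  obtain ⟨δ, CE, hδ, hCE, hE⟩ := decays_E2 (d := d) (Lc := Lc) (j + 1)
  have hB := decays_bhK (d := d) hLc hδ.le
  set CB : ℝ := cBH d Lc * Real.exp (δ * (((d : ℝ) + 1) * (2 * Lc))) with hCB
  have hCB0 : 0 ≤ CB := mul_nonneg (cBH_nonneg d Lc) (Real.exp_pos _).le
  have hw : 0 ≤ wVH d Lc (j + 1) := by unfold BalabanStepJetsSucc.wVH; positivity
  have hs : 0 ≤ stepScale d Lc (j + 1) := (stepScale_pos (j + 1)).le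
  refine ⟨δ, wVH d Lc (j + 1) * CE + stepScale d Lc (j + 1) * CB, hδ, by positivity, fun x y a b => ?_⟩
  have h1 : wVH d Lc (j + 1) * |E2 d Lc (j + 1) x y a b| ≤ wVH d Lc (j + 1) * (CE * Real.exp (-δ * l1 (x - y))) :=
    mul_le_mul_of_nonneg_left (hE x y a b) hw
  have h2 : stepScale d Lc (j + 1) * |bhK Lc x y a b| ≤ stepScale d Lc (j + 1) * (CB * Real.exp (-δ * l1 (x - y))) :=
    mul_le_mul_of_nonneg_left (hB x y a b) hs
  have hA : 0 ≤ wVH d Lc (j + 1) * (CE * Real.exp (-δ * l1 (x - y))) := by positivity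
  have hB' : 0 ≤ stepScale d Lc (j + 1) * (CB * Real.exp (-δ * l1 (x - y))) := by positivity
  have etot : wVH d Lc (j + 1) * (CE * Real.exp (-δ * l1 (x - y))) + stepScale d Lc (j + 1) * (CB * Real.exp (-δ * l1 (x - y))) =
      (wVH d Lc (j + 1) * CE + stepScale d Lc (j + 1) * CB) * Real.exp (-δ * l1 (x - y)) := by ring
  rcases a with κ | κ <;> rcases b with l | l
  · rw [bhKStep_succ_inl_inl, abs_mul, abs_of_nonneg hw, ← etot]
    exact h1.trans (le_add_of_nonneg_right hB')
  · rw [bhKStep_succ_inl_inr, abs_mul, abs_of_nonneg hs, ← etot]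
    exact h2.trans (le_add_of_nonneg_left hA)
  · rw [bhKStep_succ_inr_inl, abs_mul, abs_of_nonneg hs, ← etot]
    exact h2.trans (le_add_of_nonneg_left hA)
  · rw [bhKStep_succ_inr_inr, abs_zero]
    positivity

/-- [folklore] **THE STRAIGHT CANDIDATE IS SPREAD** at every level. -/
theorem spr_bhKStep : ∀ j : ℕ, Spr (bhKStep d Lc j)
  | 0 => by rw [bhKStep_zero]; exact spr_bhK (one_le_of_neZero Lc)
  | j + 1 => by
    obtain ⟨δ, C, hδ, -, h⟩ := decays_bhKStep_succ (d := d) (Lc := Lc) j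
    exact ⟨C, δ, hδ, h⟩

/-! ## §4 Action lemmas -/

/-- [folklore] The field–multiplier part of a field row of `bhKStep (j+1) ∘ X` is finitely supported in the summation variable. -/
theorem summable_bhKStep_succ_inl_inr_mul (j : ℕ) (X : MKer (d + 1) (Fib d)) (x z : Fin (d + 1) → ℤ) (κ : Fin (d + 1)) (b : Fib d) :
    Summable fun y => ∑ l : Fin (d + 1), bhKStep d Lc (j + 1) x y (Sum.inl κ) (Sum.inr l) * X y z (Sum.inr l) b := by
  refine summable_of_ne_finset_zero (s := (cube (d + 1) (2 * Lc)).image fun v => x + v) fun y hy => ?_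
  have hy' : y - x ∉ cube (d + 1) (2 * Lc) := fun h => hy (Finset.mem_image.2 ⟨y - x, h, by abel⟩)
  refine Finset.sum_eq_zero fun l _ => ?_
  rw [bhKStep_succ_inl_inr, bhK_eq_zero_of_not_mem_cube (one_le_of_neZero Lc) hy', mul_zero, zero_mul]

/-- [folklore] **ACTION LEMMA, FIELD ROWS** (under summability of the value-Hessian part):
`(bhKStep (j+1) ∘ X)(x, z, inl κ, b) = wVH·∑'_y ∑_l wΦ κ l (x − y) X y z (inl l) b − stepScale·(𝒬ᵀ_{Lc} (mcol Lc X z b))_κ(x)`. -/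
theorem comp_bhKStep_succ_inl (j : ℕ) (X : MKer (d + 1) (Fib d)) (x z : Fin (d + 1) → ℤ) (κ : Fin (d + 1)) (b : Fib d)
    (hX : Summable fun y => ∑ l : Fin (d + 1), wΦ (N := Lc ^ (j + 1)) κ l (x - y) * X y z (Sum.inl l) b) :
    comp (bhKStep d Lc (j + 1)) X x z (Sum.inl κ) b =
      wVH d Lc (j + 1) * (∑' y, ∑ l : Fin (d + 1), wΦ (N := Lc ^ (j + 1)) κ l (x - y) * X y z (Sum.inl l) b) -
        stepScale d Lc (j + 1) * contourSumAdj Lc (mcol Lc X z b) κ x := by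
  unfold ExpKernelCalculus.comp
  have e : ∀ y, ∑ f : Fib d, bhKStep d Lc (j + 1) x y (Sum.inl κ) f * X y z f b =
      wVH d Lc (j + 1) * (∑ l : Fin (d + 1), wΦ (N := Lc ^ (j + 1)) κ l (x - y) * X y z (Sum.inl l) b) +
        ∑ l : Fin (d + 1), bhKStep d Lc (j + 1) x y (Sum.inl κ) (Sum.inr l) * X y z (Sum.inr l) b := by
    intro y
    rw [Fintype.sum_sum_type, Finset.mul_sum]
    congr 1
    exact Finset.sum_congr rfl fun l _ => by rw [bhKStep_succ_inl_inl, E2_inl_inl_eq_wΦ, mul_assoc]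
  simp_rw [e]
  have s1 : Summable fun y => wVH d Lc (j + 1) * (∑ l : Fin (d + 1), wΦ (N := Lc ^ (j + 1)) κ l (x - y) * X y z (Sum.inl l) b) :=
    hX.mul_left _
  have s2 := summable_bhKStep_succ_inl_inr_mul (d := d) (Lc := Lc) j X x z κ b
  rw [s1.tsum_add s2, tsum_mul_left]
  have e2 : ∀ y, ∑ l : Fin (d + 1), bhKStep d Lc (j + 1) x y (Sum.inl κ) (Sum.inr l) * X y z (Sum.inr l) b =
      stepScale d Lc (j + 1) * ∑ l : Fin (d + 1), bhK Lc x y (Sum.inl κ) (Sum.inr l) * X y z (Sum.inr l) b := by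
    intro y
    rw [Finset.mul_sum]
    exact Finset.sum_congr rfl fun l _ => by rw [bhKStep_succ_inl_inr, mul_assoc]
  simp_rw [e2]
  rw [tsum_mul_left, tsum_bhK_inl_inr, mul_neg, sub_eq_add_neg]

/-- [folklore] **ACTION LEMMA, MULTIPLIER ROWS**: `(bhKStep (j+1) ∘ X)(x, z, inr κ, b) = stepScale·[proj Lc x = 0]·(𝒬_{Lc} (fcol X z b))_κ(quo x)`. -/
theorem comp_bhKStep_succ_inr (j : ℕ) (X : MKer (d + 1) (Fib d)) (x z : Fin (d + 1) → ℤ) (κ : Fin (d + 1)) (b : Fib d) :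
    comp (bhKStep d Lc (j + 1)) X x z (Sum.inr κ) b =
      stepScale d Lc (j + 1) * (if Torus.proj Lc x = 0 then contourSum Lc (fcol X z b) κ (quo Lc x) else 0) := by
  rw [← comp_bhK_inr]
  unfold ExpKernelCalculus.comp
  rw [← tsum_mul_left]
  refine tsum_congr fun y => ?_
  rw [Fintype.sum_sum_type, Fintype.sum_sum_type]
  simp only [bhKStep_succ_inr_inr, bhK_inr_inr, zero_mul, Finset.sum_const_zero, add_zero]
  rw [Finset.mul_sum]
  exact Finset.sum_congr rfl fun l _ => by rw [bhKStep_succ_inr_inl, mul_assoc]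

/-! ## §5 Right blindness -/

/-- [folklore] **RIGHT BLINDNESS OF THE STRAIGHT STEP CANDIDATE TO THE BLOCK-MEAN DRESSING**:
`comp (bhKStep d Lc (j+1)) (trK (piKBm (toSite r) Lc)) = bhKStep d Lc (j+1)` (in-block root). -/
theorem comp_bhKStep_trK_piKBm {r : Fin (d + 1) → ℕ} (hr : r ∈ box (d + 1) Lc) (j : ℕ) :
    comp (bhKStep d Lc (j + 1)) (trK (piKBm (toSite r) Lc)) = bhKStep d Lc (j + 1) := by
  have hLc : 1 ≤ Lc := one_le_of_neZero Lc
  obtain ⟨C, hC⟩ := exists_abs_wΦ_le (N := Lc ^ (j + 1)) (d := d)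
  funext x z a b
  rcases a with κ | κ
  · -- field rows: the value-Hessian part is windowed (finite support), hence summable
    have hX : Summable fun y => ∑ l : Fin (d + 1),
        wΦ (N := Lc ^ (j + 1)) κ l (x - y) * trK (piKBm (toSite r) Lc) y z (Sum.inl l) b := by
      refine summable_of_ne_finset_zero (s := (cube (d + 1) Lc).image fun v => z + v) fun y hy => ?_
      have hy' : y - z ∉ cube (d + 1) Lc := fun h => hy (Finset.mem_image.2 ⟨y - z, h, by abel⟩)
      refine Finset.sum_eq_zero fun l _ => ?_
      rw [trK_apply]
      rcases b with β | m
      · rw [piKBm_inl_inl, if_neg hy', mul_zero]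
      · rw [piKBm_inr_inl, mul_zero]
    rw [comp_bhKStep_succ_inl j _ x z κ b hX]
    rcases b with β | m
    · simp only [trK_apply]
      rw [tsum_mul_piKBm_inl_inl hLc hr (A := fun l y => wΦ (N := Lc ^ (j + 1)) κ l (x - y)) (fun l y => hC κ l (x - y))
        (codiff₁_wΦ_right κ x) z β, mcol_trK_piKBm_inl, contourSumAdj_zero, bhKStep_succ_inl_inl, E2_inl_inl_eq_wΦ]
      simp only [Pi.zero_apply, mul_zero, sub_zero]
    · simp only [trK_apply, piKBm_inr_inl, mul_zero, Finset.sum_const_zero, tsum_zero]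
      rw [bhKStep_succ_inl_inr, bhK_inl_inr]
      by_cases hz : Torus.proj Lc z = 0
      · rw [mcol_trK_piKBm_inr_of_coarse _ hz, if_pos hz]; ring
      · rw [mcol_trK_piKBm_inr_of_not_coarse _ hz, contourSumAdj_zero, if_neg hz]; simp
  · rw [comp_bhKStep_succ_inr]
    rcases b with β | m
    · rw [fcol_trK_piKBm_inl hLc hr, contourSum_axProjBmAt _ hLc, bhKStep_succ_inr_inl, bhK_inr_inl]
    · rw [fcol_trK_piKBm_inr, contourSum_zero, bhKStep_succ_inr_inr]
      split_ifs <;> simp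

/-! ## §6 Left blindness by transposition -/

/-- [folklore] **THE STRAIGHT CANDIDATE IS SIGN-CONJUGATE SYMMETRIC**: `trK (bhKStep (j+1)) = sgnK (bhKStep (j+1))` (`wΦ` reciprocal,
border antisymmetric as for `bhK`). -/
theorem trK_bhKStep_succ (j : ℕ) : trK (bhKStep d Lc (j + 1)) = sgnK (bhKStep d Lc (j + 1)) := by
  funext x y a b
  rw [trK_apply, sgnK_apply]
  rcases a with κ | κ <;> rcases b with l | l
  · rw [sgnF_inl, sgnF_inl, one_mul, one_mul, bhKStep_succ_inl_inl, bhKStep_succ_inl_inl, E2_inl_inl_eq_wΦ, E2_inl_inl_eq_wΦ,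
      wΦ_symm, neg_sub]
  · have h := congrFun (congrFun (congrFun (congrFun (trK_bhK (d := d) Lc) x) y) (Sum.inl κ)) (Sum.inr l)
    rw [trK_apply, sgnK_apply] at h
    rw [bhKStep_succ_inr_inl, bhKStep_succ_inl_inr, h]
    ring
  · have h := congrFun (congrFun (congrFun (congrFun (trK_bhK (d := d) Lc) x) y) (Sum.inr κ)) (Sum.inl l)
    rw [trK_apply, sgnK_apply] at h
    rw [bhKStep_succ_inl_inr, bhKStep_succ_inr_inl, h]
    ring
  · rw [bhKStep_succ_inr_inr, bhKStep_succ_inr_inr]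
    ring

/-- [folklore] **LEFT BLINDNESS**: `comp (piKBm (toSite r) Lc) (bhKStep d Lc (j+1)) = bhKStep d Lc (j+1)` — transpose of the right blindness
through `trK = sgnK` and `sgnK (trK piKBm) = trK piKBm`. -/
theorem comp_piKBm_bhKStep {r : Fin (d + 1) → ℕ} (hr : r ∈ box (d + 1) Lc) (j : ℕ) :
    comp (piKBm (toSite r) Lc) (bhKStep d Lc (j + 1)) = bhKStep d Lc (j + 1) := by
  have h : trK (comp (piKBm (toSite r) Lc) (bhKStep d Lc (j + 1))) = trK (bhKStep d Lc (j + 1)) := by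
    rw [trK_comp, trK_bhKStep_succ, ← sgnK_trK_piKBm, comp_sgnK, comp_bhKStep_trK_piKBm hr]
  have h' := congrArg trK h
  rwa [trK_trK, trK_trK] at h'

end

end Summit.QuantumFields.BalabanUV.Beta.BorderedHessian
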